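import Summits.Ventures.PercRepro.ProfileGapMonoThresholdThreeLines

/-!
# PercRepro — THE CO-RANK-3 THRESHOLD FAMILY ON EVERY MATROID WHOSE LINES HAVE AT MOST 3 POINTS (loops and
parallel points included) (p5, gen 29; `proofs/P5-GM1.md` §34(4); announced INBOX 13565)

The short-line hypothesis in its general form — no rank-`2` flat contains four pairwise non-parallel points
(every binary matroid qualifies) — passes to every single-element deletion (`lines_le_three_delete`); loops are
deleted by `thresholdIneq_of_loop`, a point of a parallel pair by `delMonoT_of_parallel` with the co-rank-`2`
theorem `thresholdIneq_two`, and the simple case is `thresholdIneq_three_of_lines_le_three`: by strong induction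
on `#E`, **`thresholdIneq_three_of_lines_le_three_all`** gives `ThresholdIneq N 3 t` for every `t ≥ 2`.
-/

open scoped Matroid

namespace PercRepro.Cogirth

open Finset ThmH Skew Shadow Profile

variable {α : Type} [DecidableEq α] {N : Matroid α} [N.Finite]

section All

variable {t : ℕ}

/-- **The short-line hypothesis passes to a deletion**: if no rank-`2` flat of `N` carries four pairwise non-parallel
points, neither does any rank-`2` flat of `N ∖ z` (`cl_{N∖z} B ⊆ cl_N B`, ranks of sets avoiding `z` unchanged). -/
theorem lines_le_three_delete (z : α)
    (hline : ∀ B ∈ Rq N 2, ∀ T ⊆ clF N B, (∀ x ∈ T, ∀ y ∈ T, x ≠ y → rk N {x, y} = 2) → T.card ≤ 3) :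
    ∀ B ∈ Rq (N ＼ ({z} : Set α)) 2, ∀ T ⊆ clF (N ＼ ({z} : Set α)) B,
      (∀ x ∈ T, ∀ y ∈ T, x ≠ y → rk (N ＼ ({z} : Set α)) {x, y} = 2) → T.card ≤ 3 := by
  intro B hB T hT hpair
  obtain ⟨hBg, hBr⟩ := mem_Rq.1 hB
  rw [gr_delete'] at hBg
  have hBg' : B ⊆ gr N := hBg.trans (erase_subset _ _)
  have hBrk : rk (N ＼ ({z} : Set α)) B = 2 := rk_eq_of_eRk_eq_cq hBr
  rw [rk_delete hBg] at hBrk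
  have hBq : B ∈ Rq N 2 := mem_Rq.2 ⟨hBg', eRk_eq_of_rk_eq_cq hBrk⟩
  have hTg : T ⊆ (gr N).erase z := by
    intro y hy
    have := clF_subset_gr (M := N ＼ ({z} : Set α)) B (hT hy)
    rwa [gr_delete'] at this
  apply hline B hBq T
  · intro y hy
    have hyg : y ∈ (gr N).erase z := hTg hy
    have h1 := (mem_clF_iff_rk_insert (M := N ＼ ({z} : Set α)) (by rw [gr_delete']; exact hyg)
      (by rw [gr_delete']; exact hBg)).1 (hT hy)
    rw [rk_delete (insert_subset hyg hBg), rk_delete hBg] at h1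
    exact (mem_clF_iff_rk_insert (mem_of_mem_erase hyg) hBg').2 h1
  · intro x hx y hy hxy
    have h := hpair x hx y hy hxy
    rwa [rk_delete (insert_subset (hTg hx) (singleton_subset_iff.2 (hTg hy)))] at h

/-- **THE CO-RANK-3 THRESHOLD FAMILY ON EVERY MATROID WHOSE LINES HAVE AT MOST 3 POINTS**: if no rank-`2` flat of
`N` contains four pairwise non-parallel points (every binary matroid), then `ThresholdIneq N 3 t` for every `t ≥ 2`
— loops and parallel points are deleted by the tree's reductions (strong induction on `#E`), the simple case is
`thresholdIneq_three_of_lines_le_three`. -/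
theorem thresholdIneq_three_of_lines_le_three_all
    (hline : ∀ B ∈ Rq N 2, ∀ T ⊆ clF N B, (∀ x ∈ T, ∀ y ∈ T, x ≠ y → rk N {x, y} = 2) → T.card ≤ 3)
    (ht : 2 ≤ t) : ThresholdIneq N 3 t := by
  suffices H : ∀ n, ∀ (N : Matroid α) [N.Finite], (gr N).card = n →
      (∀ B ∈ Rq N 2, ∀ T ⊆ clF N B, (∀ x ∈ T, ∀ y ∈ T, x ≠ y → rk N {x, y} = 2) → T.card ≤ 3) →
      ThresholdIneq N 3 t from H _ N rfl hline
  intro n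
  induction n using Nat.strong_induction_on with
  | _ n ih =>
  intro N _ hn hline
  by_cases hloop : ∃ ℓ ∈ gr N, rk N {ℓ} = 0
  · -- a loop: delete it
    obtain ⟨ℓ, hℓ, h0⟩ := hloop
    have hpos : 0 < (gr N).card := card_pos.2 ⟨ℓ, hℓ⟩
    refine thresholdIneq_of_loop hℓ h0 (ih _ ?_ _ rfl (lines_le_three_delete ℓ hline))
    rw [gr_delete', card_erase_of_mem hℓ]
    omega
  push Not at hloop
  by_cases hpar : ∃ z ∈ gr N, ∃ z' ∈ gr N, z ≠ z' ∧ rk N {z, z'} = 1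
  · -- a parallel pair: delete one of its points
    obtain ⟨z, hz, z', hz', hzz', h1⟩ := hpar
    have hz1 : rk N {z} = 1 := by
      have hle : rk N {z} ≤ ({z} : Finset α).card := rk_le_card _
      rw [card_singleton] at hle
      have := hloop z hz
      omega
    have hz1' : rk N {z'} = 1 := by
      have hle : rk N {z'} ≤ ({z'} : Finset α).card := rk_le_card _
      rw [card_singleton] at hle
      have := hloop z' hz'
      omega
    have hdel : ThresholdIneq (N ＼ ({z} : Set α) ／ ({z'} : Set α)) (3 - 1) (t - 1) :=
      thresholdIneq_two _ (by omega)
    refine thresholdIneq_of_delMonoT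
      (delMonoT_of_parallel hz hz' hzz' hz1 hz1' h1 (by norm_num) (by omega) hdel) ?_
    have hpos : 0 < (gr N).card := card_pos.2 ⟨z, hz⟩
    refine ih _ ?_ _ rfl (lines_le_three_delete z hline)
    rw [gr_delete', card_erase_of_mem hz]
    omega
  push Not at hpar
  -- simple: every pair of distinct points has rank `2`
  have hpair : ∀ x ∈ gr N, ∀ y ∈ gr N, x ≠ y → rk N {x, y} = 2 := by
    intro x hx y hy hxy
    have hne1 := hpar x hx y hy hxy
    have hle : rk N {x, y} ≤ ({x, y} : Finset α).card := rk_le_card _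
    rw [card_pair hxy] at hle
    have hx1 : rk N {x} = 1 := by
      have hle' : rk N {x} ≤ ({x} : Finset α).card := rk_le_card _
      rw [card_singleton] at hle'
      have := hloop x hx
      omega
    have hmono : rk N {x} ≤ rk N {x, y} := rk_mono' (singleton_subset_iff.2 (mem_insert_self _ _))
    omega
  apply thresholdIneq_three_of_lines_le_three hpair _ ht
  intro B hB
  exact hline B hB (clF N B) (Subset.refl _)
    (fun x hx y hy hxy => hpair x (clF_subset_gr B hx) y (clF_subset_gr B hy) hxy)

end All

end PercRepro.Cogirth
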